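import Literature.Probability.Percolation.ArmSeparationIntReroute
import Literature.Probability.Percolation.ArmSeparationRotate
import HarnessLib

/-!
# Inner separation of two arms: fenced inner tips and compatibility of their free spaces

Topic: Probability / Percolation; family `crit-perc`. The deterministic half of Kesten's
separation step at the INNER boundary for the two-arm event `armEvent ![true,false] m N` on the
hexagonal annulus `Λ_N ∖ Λ̊_m` (Nolin 2008, §4.4, proof of Thm. 11 [arXiv 0711.4948: Thm. 10],
"2. Internal extremities: the reasoning is the same … from `∂S_{2^k}` toward the interior"), for
`j = 2`, `σ = BW`; the internal twin of `ArmSeparationOuter.lean`: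

* `IntFencedArm m A k₀ K R₀ χ` — the data of a **fenced arm leaving the right side of `∂Λ_m`**
  (side `1` of `TriHalfAnnulus.lean`, `{x₀ = m}`) inside a region `A` (the annulus `{m ≤ |v| ≤ N}`,
  possibly enlarged by outer free spaces) in the configuration `χ` (colour = `χ`-open): a middle
  tip `z` (`IsIntJ m z`, `IntMidTip m R₀ z`), a scale `k = k₀ · 32^j`, `j < K`, a fenced protected
  tip (`IntTipOK`: an open vertical crossing of the inner box `[m-2k, m-k] × [z₁+k, z₁+2k]` through
  `mm`, protection from above at scale `8k`), an open path of `A` continued through the fence zone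
  from the far end `b` (`|b| > 2m`) of the arm to `mm`, and an open path of `A` from `b` to the tip.
* `exists_intFencedArm` — from `HalfAnnulus.int_reroute_of_region`: if the exploration sequence of
  `χ` in `intDom m` stops before `T`, no middle term fails and the corner guards (closed frames about
  the two ends of the side among the scales `R₀ · 32^i`, `i < Kg`) are present, every `χ`-open path
  of `A` from the right side of `∂Λ_m` to norm `> 2m` is fenced (the guards first force the
  endpoint into the tip arc, `HalfAnnulus.tip_bounds_of_guards`).
* `InFail`, `InGuard`, `InGood` and `exists_two_intFencedArm` — **on the two-arm event, if
  nothing fails around `∂Λ_m` in the twelve rotated / colour-exchanged configurations, the open arm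
  is fenced in some `rotConfig io ω` and the closed arm in some `(rotConfig ic ω)ᶜ`.**
* **Compatibility** — the inner free spaces of the two arms use disjoint sets of sites of `Λ̊_m`:
  with `intRegion` the sites of `Λ̊_m ∩ {x₀ ≥ 0}` strictly above the tip's row in the square of
  half-width `2k+1` (containing the inner part of the fence zone and the fence box), and `d` the
  relative rotation, `Disjoint intRegion(open) (ρ^d '' intRegion(closed))`: for `d = 0` the rows
  separate once the tips are `8k` apart, which the protection of the LOWER tip enforces
  (`int_compatible_same`, `int_compatible_same₂` for two regions); for `d ≠ 0` the middle-tip margins `R₀ ≥ 2k + 1` and `64k < m` separate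
  the coordinates (`int_compatible_rot`). Assembled in `disjoint_intRegion_image`.

## References

* P. Nolin, *Near-critical percolation in two dimensions*, Electron. J. Probab. 13 (2008), §4.2
  (well-separateness, free spaces on the internal boundary), §4.4 (proof of Thm. 11, internal
  extremities) [arXiv 0711.4948: Def. 6–8, Thm. 10]. [Nolin2008]
* H. Kesten, *Scaling relations for 2D-percolation*, Comm. Math. Phys. 109 (1987), Lemma 2. [Kesten1987]

Tree: `HalfAnnulus.int_reroute_of_region`, `IntTipOK`, `le_tip_of_compl_mem_triFrameAt` (pattern)
(`ArmSeparationIntReroute.lean`); `IntSeqFail`, `IntMidTip` (`ArmSeparationIntFenceBound.lean`);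
`intFrameZone`, `mem_intFrameZone` (`ArmSeparationIntFrame.lean`); `rotConfig`, `pathIn_rotConfig`,
`exists_rot_symm_apply_zero_eq`, `rot_apply_formula`, `triRotIsoPow_*` (`ArmSeparationRotate.lean`);
`trapRSW`, `trapScale`, `trapScale_mono`, `one_le_trapScale` (`ArmSeparationFenceBound.lean`);
`triAnnSet` (`ArmSeparationReroute.lean`); `FrameData.exists_mem_K`, `K_subset`, `nonempty_frameData`
(`ArmSeparationFrame.lean`); `mem_armEvent_one_iff_exists_pathIn` (`ArmEventsAPriori.lean`),
`armEvent_two_eq_inter` (`ArmEventsStructure.lean`).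
-/

noncomputable section

open Set

namespace Literature.Probability.Percolation

open LatticeModels HalfAnnulus

/-! ### Fenced arms at the inner boundary -/

/-- **A fenced arm leaving the right side of `∂Λ_m`** inside the region `A` in the configuration
`χ` (Nolin 2008, §4.2, Def. 6–8 on the internal boundary, the data `(z_i, r_i, c̃_i)` for one
arm): a middle tip `z` of the tip arc, a scale index `j < K` (scale `k = k₀ · 32^j`), a fenced
protected tip `IntTipOK m z k χ mm`, a `χ`-open path of `A` continued through the fence zone
`intFrameZone m z k` from the far end `b` of the arm (`|b| > 2m`) to `mm`, and a `χ`-open path of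
`A` from `b` to the tip `z`. [cite: Nolin2008, §4.2 Def. 6–8 (arXiv 0711.4948)] -/
structure IntFencedArm (m : ℕ) (A : Set (Site 2)) (k₀ K R₀ : ℕ) (χ : SiteConfig (Site 2)) where
  /-- the tip -/
  z : Site 2
  /-- the scale index -/
  j : ℕ
  /-- the site of the fence through which the vertical crossing passes -/
  mm : Site 2
  /-- the far end of the arm, a site beyond `Λ_{2m}` -/
  b : Site 2
  z_isIntJ : IsIntJ m z
  z_mid : IntMidTip m R₀ z
  j_lt : j < K
  b_far : 2 * (m : ℤ) < triNorm b
  tipOK : IntTipOK m z (trapScale k₀ j) χ mm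
  path : PathIn triGraph ((A ∪ intFrameZone m z (trapScale k₀ j)) ∩ χ) b mm
  path_tip : PathIn triGraph (A ∩ χ) b z

namespace IntFencedArm

variable {m k₀ K R₀ : ℕ} {A : Set (Site 2)} {χ : SiteConfig (Site 2)}

/-- The scale of a fenced arm. [folklore] -/
def k (F : IntFencedArm m A k₀ K R₀ χ) : ℕ := trapScale k₀ F.j

/-- **The interior region of a fenced arm**: the sites of `Λ̊_m ∩ {x₀ ≥ 0}` strictly above the
row of the tip in the square of half-width `2k + 1` about the tip — containing the interior part
of the fence zone and the fence box. [cite: Nolin2008, §4.2 Def. 7 (free spaces on the internal boundary) (arXiv 0711.4948)] -/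
def intRegion (F : IntFencedArm m A k₀ K R₀ χ) : Set (Site 2) :=
  {v | 0 ≤ v 0 ∧ triNorm v < m ∧ F.z 1 < v 1 ∧ v 1 ≤ F.z 1 + (2 * F.k + 1) ∧ F.z 0 - (2 * F.k + 1) ≤ v 0}

/-- Membership in the interior region, unfolded. [folklore] -/
theorem mem_intRegion {F : IntFencedArm m A k₀ K R₀ χ} {v : Site 2} :
    v ∈ F.intRegion ↔ 0 ≤ v 0 ∧ triNorm v < m ∧ F.z 1 < v 1 ∧ v 1 ≤ F.z 1 + (2 * F.k + 1) ∧
      F.z 0 - (2 * F.k + 1) ≤ v 0 := Iff.rfl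

/-- The interior part of the fence zone lies in the interior region. [folklore] -/
theorem mem_intRegion_of_mem_zone {F : IntFencedArm m A k₀ K R₀ χ} {v : Site 2}
    (hv : v ∈ intFrameZone m F.z F.k) (hn : triNorm v < m) : v ∈ F.intRegion := by
  rw [mem_intFrameZone] at hv
  obtain ⟨h1, h2, h3, h4, h5⟩ := hv
  rcases h1 with h1 | h1
  · have := (mem_haSet.1 h1).2.1; omega
  · exact ⟨(mem_hinSet.1 h1.1).1, hn, h1.2, h5, h2⟩

/-- The fence box `[m-2k, m-k] × [z₁+k, z₁+2k]` lies in the interior region (`R₀ ≥ 2k + 1`). [folklore] -/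
theorem mem_intRegion_of_mem_box {F : IntFencedArm m A k₀ K R₀ χ} {v : Site 2} (hk : 1 ≤ F.k)
    (hkR : 2 * F.k + 1 ≤ R₀) (hkm : 2 * F.k ≤ m)
    (hv : v ∈ triStrip (F.z 0 - 2 * F.k) (F.z 1 + F.k) F.k F.k) : v ∈ F.intRegion := by
  rw [mem_triStrip] at hv
  obtain ⟨hz0, -, -⟩ := F.z_isIntJ
  obtain ⟨hm1, hm2⟩ := F.z_mid
  have hk' : (1 : ℤ) ≤ F.k := by exact_mod_cast hk
  have hkR' : 2 * (F.k : ℤ) + 1 ≤ R₀ := by exact_mod_cast hkR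
  have hkm' : 2 * (F.k : ℤ) ≤ m := by exact_mod_cast hkm
  refine ⟨by omega, triNorm_lt_iff_lin.2 (by omega), by omega, by omega, by omega⟩

/-- The tip of a fenced arm is an open site. [folklore] -/
theorem z_mem_config (F : IntFencedArm m A k₀ K R₀ χ) : F.z ∈ χ := F.path_tip.right_mem.2

/-- The tip of a fenced arm is a site of the tip arc of `intDom m`. [folklore] -/
theorem z_mem_J (F : IntFencedArm m A k₀ K R₀ χ) : F.z ∈ (intDom m).J := by
  obtain ⟨hz0, hz1, hz2⟩ := F.z_isIntJ
  refine mem_intDom_J.2 ⟨mem_haFin.2 ⟨by omega, le_triNorm_iff_lin.2 (by omega), triNorm_le_iff_lin.2 (by omega)⟩,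
    hz0, hz1, hz2⟩

end IntFencedArm

/-! ### Corner guards force the inner endpoint of an arm into the tip arc -/

namespace HalfAnnulus

variable {m : ℕ}

/-- A site of norm at least `2m` lies outside the box of half-width `2R` about a point `(m, e)` of
the right side, when `4R < m`. [folklore] -/
theorem far_of_two_mul_le_triNorm {R : ℕ} (hRm : 4 * R < m) {b : Site 2} (hb : 2 * (m : ℤ) ≤ triNorm b) (e : ℤ)
    (he : -(m : ℤ) ≤ e ∧ e ≤ 0) :
    b 0 ≤ (m : ℤ) - 2 * R ∨ (m : ℤ) + 2 * R ≤ b 0 ∨ b 1 ≤ e - 2 * R ∨ e + 2 * R ≤ b 1 := by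
  have hRm' : 4 * (R : ℤ) < m := by exact_mod_cast hRm
  have hge := le_triNorm_iff_lin.1 hb
  omega

/-- **Closed frames around the ends of the side force the inner endpoint of an open arm into the
middle of the side**: if the closed sites of `ω` contain frames at scales `R₁`, `R₂` (`1 ≤ Rᵢ`,
`4Rᵢ < m`) about `(m, -m)` and `(m, 0)`, then an `ω`-open `𝕋`-path from a site `y` of the right
side (`y₀ = m = |y|`) to a site `b` of norm `≥ 2m` has `-m + R₁ ≤ y₁ ≤ -R₂` — otherwise it would
meet a closed frame (`FrameData.exists_mem_K`). [cite: Nolin2008, §4.4 Thm. 11 (proof, internal extremities) (arXiv 0711.4948: Thm. 10)] -/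
theorem tip_bounds_of_guards {R₁ R₂ : ℕ} (h₁ : 1 ≤ R₁) (h₁m : 4 * R₁ < m) (h₂ : 1 ≤ R₂) (h₂m : 4 * R₂ < m)
    {ω : SiteConfig (Site 2)} (hdn : ωᶜ ∈ triFrameAt ![(m : ℤ), -(m : ℤ)] R₁) (hup : ωᶜ ∈ triFrameAt ![(m : ℤ), 0] R₂)
    {A : Set (Site 2)} {y b : Site 2} (hy0 : y 0 = m) (hyn : triNorm y = m) (hb : 2 * (m : ℤ) ≤ triNorm b)
    (hp : PathIn triGraph (A ∩ ω) y b) : -(m : ℤ) + R₁ ≤ y 1 ∧ y 1 ≤ -(R₂ : ℤ) := by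
  have hyle := triNorm_le_iff_lin.1 hyn.le
  constructor
  · by_contra hlt
    rw [not_le] at hlt
    obtain ⟨F⟩ := nonempty_frameData hdn
    have ht := far_of_two_mul_le_triNorm h₁m hb (-(m : ℤ)) ⟨le_rfl, by omega⟩
    obtain ⟨v, hvA, hvK⟩ := F.exists_mem_K h₁ (s := y) (t := b)
      (by simp only [Matrix.cons_val_zero, Matrix.cons_val_one, Matrix.cons_val_fin_one]; omega)
      (by simp only [Matrix.cons_val_zero, Matrix.cons_val_one, Matrix.cons_val_fin_one]; omega) hp
    exact F.K_subset hvK hvA.2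
  · by_contra hlt
    rw [not_le] at hlt
    obtain ⟨F⟩ := nonempty_frameData hup
    have ht := far_of_two_mul_le_triNorm h₂m hb 0 ⟨by omega, le_rfl⟩
    obtain ⟨v, hvA, hvK⟩ := F.exists_mem_K h₂ (s := y) (t := b)
      (by simp only [Matrix.cons_val_zero, Matrix.cons_val_one, Matrix.cons_val_fin_one]; omega)
      (by simp only [Matrix.cons_val_zero, Matrix.cons_val_one, Matrix.cons_val_fin_one]; omega) hp
    exact F.K_subset hvK hvA.2

end HalfAnnulus

/-! ### The failure events and fenced arms -/

/-- **A corner guard**: among the scales `R₀ · 32^i`, `i < Kg`, the closed sites of `χ` realise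
the per-scale RSW event `trapRSW C R` (two frames) about the point `C` (an end of the side). Its
failure probability is that of `real_iInter_compl_trapRSW_le` by colour symmetry. [cite: Nolin2008, §4.4 Thm. 11 (proof, internal extremities) (arXiv 0711.4948: Thm. 10)] -/
def InGuard (R₀ Kg : ℕ) (C : Site 2) (χ : SiteConfig (Site 2)) : Prop :=
  ∃ i < Kg, χᶜ ∈ trapRSW C (trapScale R₀ i)

/-- **Failure at the inner side `1`** for the colour `χ`-open: the exploration sequence of
`intDom m` in `χ` has a `T`-th term, or some middle term `u < T` fails on all scales. [cite: Nolin2008, §4.4 Lemma 15 (arXiv 0711.4948: Lemma 14)] -/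
def InFail (m T k₀ K R₀ : ℕ) (χ : SiteConfig (Site 2)) : Prop :=
  (intDom m).lowestSeq χ T ≠ none ∨ IntSeqFail m T k₀ K R₀ χ

/-- **Nothing fails around `∂Λ_m`**: in each of the twelve rotated / colour-exchanged
configurations `rotConfig i ω`, `(rotConfig i ω)ᶜ` (`i < 6`) there is no failure at the inner side
`1` and both corner guards are present. [cite: Nolin2008, §4.4 (arXiv 0711.4948: proof of Thm. 10, internal extremities)] -/
def InGood (m T k₀ K R₀ Kg : ℕ) (ω : SiteConfig (Site 2)) : Prop :=
  ∀ i < 6,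
    (¬ InFail m T k₀ K R₀ (rotConfig i ω) ∧ InGuard R₀ Kg ![(m : ℤ), -(m : ℤ)] (rotConfig i ω) ∧
        InGuard R₀ Kg ![(m : ℤ), 0] (rotConfig i ω)) ∧
      (¬ InFail m T k₀ K R₀ (rotConfig i ω)ᶜ ∧ InGuard R₀ Kg ![(m : ℤ), -(m : ℤ)] (rotConfig i ω)ᶜ ∧
        InGuard R₀ Kg ![(m : ℤ), 0] (rotConfig i ω)ᶜ)

/-- `R₀ ≤ R₀ · 32^i`. [folklore] -/
theorem le_trapScale (R₀ i : ℕ) : R₀ ≤ trapScale R₀ i := by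
  unfold trapScale
  exact Nat.le_mul_of_pos_right _ (Nat.one_le_pow _ _ (by norm_num))

/-- **Fenced arms exist when nothing fails** (`HalfAnnulus.int_reroute_of_region`), with the far
end recorded: in a region `A` of sites of norm `≥ m` containing `HA(m)` (`m ≥ 5`), no failure at the
inner side, both corner guards (`4 · R₀ 32^i < m` for `i < Kg`, `R₀ ≥ 2`), and a `χ`-open path of
`A` from a site `y` of the right side of `∂Λ_m` (`y₀ = m = |y|`) to a site `b` of norm `> 2m` yield
a fenced arm with far end `b`. [cite: Nolin2008, §4.4 Thm. 11 (proof, internal extremities) (arXiv 0711.4948: Thm. 10, Lemma 14)] -/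
theorem exists_intFencedArm_b_eq {m T k₀ K R₀ Kg : ℕ} (hm : 5 ≤ m) {A : Set (Site 2)} (hA : ∀ v ∈ A, (m : ℤ) ≤ triNorm v)
    (hHA : haSet m ⊆ A) (hR₀ : 2 ≤ R₀) (hRg : ∀ i < Kg, 4 * trapScale R₀ i < m) {χ : SiteConfig (Site 2)}
    (hfail : ¬ InFail m T k₀ K R₀ χ) (hdn : InGuard R₀ Kg ![(m : ℤ), -(m : ℤ)] χ) (hup : InGuard R₀ Kg ![(m : ℤ), 0] χ)
    {y b : Site 2} (hy0 : y 0 = m) (hyn : triNorm y = m) (hb : 2 * (m : ℤ) < triNorm b)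
    (hp : PathIn triGraph (A ∩ χ) y b) : ∃ F : IntFencedArm m A k₀ K R₀ χ, F.b = b := by
  obtain ⟨i₁, hi₁, h₁⟩ := hdn
  obtain ⟨i₂, hi₂, h₂⟩ := hup
  have hR₁ := le_trapScale R₀ i₁
  have hR₂ := le_trapScale R₀ i₂
  obtain ⟨hlo, hhi⟩ := tip_bounds_of_guards (by omega) (hRg i₁ hi₁) (by omega) (hRg i₂ hi₂) h₁.1 h₂.1 hy0 hyn hb.le hp
  have hR₁' : (R₀ : ℤ) ≤ trapScale R₀ i₁ := by exact_mod_cast hR₁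
  have hR₂' : (R₀ : ℤ) ≤ trapScale R₀ i₂ := by exact_mod_cast hR₂
  have hR₀' : (2 : ℤ) ≤ R₀ := by exact_mod_cast hR₀
  have hyJ : IsIntJ m y := ⟨hy0, by linarith, by linarith⟩
  simp only [InFail, not_or, not_not] at hfail
  obtain ⟨z, hzJ, hmid, j, hj, mm, hOK, hpath, htip⟩ := int_reroute_of_region hm hA hHA (by omega) hR₁ (hRg i₁ hi₁) hR₂
    (hRg i₂ hi₂) hfail.1 hfail.2 h₁.1 h₂.1 hyJ (Or.inr hb) hp
  exact ⟨⟨z, j, mm, b, hzJ, hmid, hj, hb, hOK, hpath, htip⟩, rfl⟩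

/-- **Fenced arms exist when nothing fails** (`HalfAnnulus.int_reroute_of_region`): in a region
`A` of sites of norm `≥ m` containing `HA(m)` (`m ≥ 5`), no failure at the inner side, both corner
guards (`4 · R₀ 32^i < m` for `i < Kg`, `R₀ ≥ 2`), and a `χ`-open path of `A` from a site `y` of the
right side of `∂Λ_m` (`y₀ = m = |y|`) to a site `b` of norm `> 2m` yield a fenced arm. [cite: Nolin2008, §4.4 Thm. 11 (proof, internal extremities) (arXiv 0711.4948: Thm. 10, Lemma 14)] -/
theorem exists_intFencedArm {m T k₀ K R₀ Kg : ℕ} (hm : 5 ≤ m) {A : Set (Site 2)} (hA : ∀ v ∈ A, (m : ℤ) ≤ triNorm v)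
    (hHA : haSet m ⊆ A) (hR₀ : 2 ≤ R₀) (hRg : ∀ i < Kg, 4 * trapScale R₀ i < m) {χ : SiteConfig (Site 2)}
    (hfail : ¬ InFail m T k₀ K R₀ χ) (hdn : InGuard R₀ Kg ![(m : ℤ), -(m : ℤ)] χ) (hup : InGuard R₀ Kg ![(m : ℤ), 0] χ)
    {y b : Site 2} (hy0 : y 0 = m) (hyn : triNorm y = m) (hb : 2 * (m : ℤ) < triNorm b)
    (hp : PathIn triGraph (A ∩ χ) y b) : Nonempty (IntFencedArm m A k₀ K R₀ χ) := by
  obtain ⟨F, -⟩ := exists_intFencedArm_b_eq hm hA hHA hR₀ hRg hfail hdn hup hy0 hyn hb hp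
  exact ⟨F⟩

/-- **An arm leaves the right side of some rotated frame.** If `ω ∈ armEvent ![c] m N` (`m ≤ N`)
then for some `i < 6` the rotated configuration `rotConfig i ω` has a colour-`c` `𝕋`-path of the
annulus `{m ≤ |v| ≤ N}` from a site `y` of the right side of `∂Λ_m` (`y₀ = m = |y|`) to a site of
norm `N`. [cite: Nolin2008, §4.4 (arXiv 0711.4948: proof of Thm. 10)] -/
theorem exists_rightSide_pathIn_rotConfig {c : Bool} {m N : ℕ} (hmN : m ≤ N) {ω : SiteConfig (Site 2)}
    (h : ω ∈ armEvent ![c] m N) :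
    ∃ i < 6, ∃ y b : Site 2, y 0 = m ∧ triNorm y = m ∧ triNorm b = N ∧
      PathIn triGraph (triAnnSet m N ∩ {v | v ∈ rotConfig i ω ↔ c}) y b := by
  obtain ⟨x, hx, y, hy, hp⟩ := (mem_armEvent_one_iff_exists_pathIn hmN).1 h
  rw [mem_triSphere_iff] at hx hy
  obtain ⟨i, hi, hi0⟩ := exists_rot_symm_apply_zero_eq x
  refine ⟨i, hi, (triRotIsoPow i).symm x, (triRotIsoPow i).symm y, by rw [hi0, hx], by rw [triNorm_rot_symm, hx],
    by rw [triNorm_rot_symm, hy], pathIn_rotConfig i hp⟩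

/-- **On the two-arm event, if nothing fails around `∂Λ_m`, both arms are fenced at their inner
ends**: the open arm in some rotated frame `rotConfig io ω`, the closed arm (an open arm of the
complement) in some `(rotConfig ic ω)ᶜ` (`m ≥ 5`, `2m < N`, `R₀ ≥ 2`, `4 · R₀ 32^i < m`). [cite: Nolin2008, §4.4 (arXiv 0711.4948: proof of Thm. 10, internal extremities)] -/
theorem exists_two_intFencedArm {m N T k₀ K R₀ Kg : ℕ} (hm : 5 ≤ m) (hN : 2 * m < N) (hR₀ : 2 ≤ R₀)
    (hRg : ∀ i < Kg, 4 * trapScale R₀ i < m) {ω : SiteConfig (Site 2)}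
    (hgood : InGood m T k₀ K R₀ Kg ω) (harm : ω ∈ armEvent ![true, false] m N) :
    ∃ io < 6, ∃ ic < 6, Nonempty (IntFencedArm m (triAnnSet m N) k₀ K R₀ (rotConfig io ω)) ∧
      Nonempty (IntFencedArm m (triAnnSet m N) k₀ K R₀ (rotConfig ic ω)ᶜ) := by
  rw [armEvent_two_eq_inter] at harm
  obtain ⟨ho, hc⟩ := harm
  obtain ⟨io, hio, yo, bo, hyo0, hyon, hbo, hpo⟩ := exists_rightSide_pathIn_rotConfig (by omega : m ≤ N) ho
  obtain ⟨ic, hic, yc, bc, hyc0, hycn, hbc, hpc⟩ := exists_rightSide_pathIn_rotConfig (by omega : m ≤ N) hc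
  rw [setOf_mem_iff_true] at hpo
  rw [setOf_mem_iff_false] at hpc
  obtain ⟨⟨hfo, hdo, huo⟩, -⟩ := hgood io hio
  obtain ⟨-, ⟨hfc, hdc, huc⟩⟩ := hgood ic hic
  have hA : ∀ v ∈ triAnnSet m N, (m : ℤ) ≤ triNorm v := fun _ hv => (mem_triAnnSet.1 hv).1
  have hHA : haSet m ⊆ triAnnSet m N := haSet_subset_triAnnSet hN.le
  have hbo' : 2 * (m : ℤ) < triNorm bo := by rw [hbo]; exact_mod_cast hN
  have hbc' : 2 * (m : ℤ) < triNorm bc := by rw [hbc]; exact_mod_cast hN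
  exact ⟨io, hio, ic, hic, exists_intFencedArm hm hA hHA hR₀ hRg hfo hdo huo hyo0 hyon hbo' hpo,
    exists_intFencedArm hm hA hHA hR₀ hRg hfc hdc huc hyc0 hycn hbc' hpc⟩

/-! ### Compatibility of the inner free spaces -/

section Compatibility

variable {m k₀ K R₀ : ℕ} {A : Set (Site 2)}

/-- **Arms leave the neighbourhood of a tip through the half-annulus**: a `𝕋`-path inside a
region `A` of sites of norm `≥ m`, of colour `ψ`, from a site `s` of the open box of half-width `16k`
about a point `z` of the tip arc to a site `a` of norm `> 2m` contains a path of `HA(m)` of colour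
`ψ` from `s` to a site outside that open box (`32k + 1 ≤ m`: inside the box the region lies in the
half-annulus, and `a` is outside). [folklore] -/
theorem exists_pathIn_haSet_exit {z s a : Site 2} {k : ℕ} {ψ : Set (Site 2)} (hA : ∀ v ∈ A, (m : ℤ) ≤ triNorm v)
    (hz : IsIntJ m z) (hkm : 32 * k + 1 ≤ m) (ha : 2 * (m : ℤ) < triNorm a)
    (hs : z 0 - 16 * k < s 0 ∧ s 0 < z 0 + 16 * k ∧ z 1 - 16 * k < s 1 ∧ s 1 < z 1 + 16 * k)
    (hp : PathIn triGraph (A ∩ ψ) s a) :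
    ∃ t : Site 2, (t 0 ≤ z 0 - 16 * k ∨ z 0 + 16 * k ≤ t 0 ∨ t 1 ≤ z 1 - 16 * k ∨ z 1 + 16 * k ≤ t 1) ∧
      PathIn triGraph (haSet m ∩ ψ) s t := by
  obtain ⟨hz0, hz1, hz2⟩ := hz
  have hkm' : 32 * (k : ℤ) + 1 ≤ m := by exact_mod_cast hkm
  set R : Set (Site 2) := {v | z 0 - 16 * k < v 0 ∧ v 0 < z 0 + 16 * k ∧ z 1 - 16 * k < v 1 ∧ v 1 < z 1 + 16 * k}
    with hR
  have hbox : ∀ v ∈ R, 0 ≤ v 0 ∧ triNorm v ≤ 2 * (m : ℤ) - 1 := by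
    intro v hv
    simp only [hR, Set.mem_setOf_eq] at hv
    exact ⟨by omega, triNorm_le_iff_lin.2 (by omega)⟩
  have hsR : s ∈ R := hs
  have haR : a ∉ R := fun h => by have := (hbox a h).2; omega
  obtain ⟨p, t, hpR, htR, htA, hpt, hsp⟩ := hp.exit hsR haR
  have hinH : ∀ v ∈ R ∩ (A ∩ ψ), v ∈ haSet m ∩ ψ := by
    rintro v ⟨hvR, hvA, hvψ⟩
    have hb := hbox v hvR
    exact ⟨mem_haSet.2 ⟨hb.1, hA v hvA, by omega⟩, hvψ⟩
  have hpR' := hpR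
  simp only [hR, Set.mem_setOf_eq] at hpR' htR
  have ht0 := (triGraph_adj_coord hpt 0).1
  have htn := triNorm_le_triNorm_add_one_of_adj hpt
  have hpn := (hbox p hpR).2
  have htm := hA t htA.1
  exact ⟨t, by omega, (hsp.mono hinH).tail hpt ⟨mem_haSet.2 ⟨by omega, htm, by omega⟩, htA.2⟩⟩

/-- **Protection separates tips on the same side** (two regions): for a fenced arm of colour `χb`
(region `A`) and a fenced arm of a colour `χx` disjoint from `χb` (region `B`, of sites of norm
`≥ m`), if the second tip lies strictly above the first then it is more than `8k` above it (`k`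
the scale of the FIRST arm): otherwise it is a site of `J_{>z}` inside the inner box joined by a
`χbᶜ`-path of the half-annulus to a far site, which the protection clause of the first tip forbids
(`64k < m`). [cite: Nolin2008, §4.4 Lemma 15 (proof) (arXiv 0711.4948: Lemma 14)] -/
theorem int_row_gap_of_lt₂ {B : Set (Site 2)} (hB : ∀ v ∈ B, (m : ℤ) ≤ triNorm v) (hKm : ∀ j < K, 64 * trapScale k₀ j < m)
    {χb χx : SiteConfig (Site 2)} (hcol : ∀ v, v ∈ χx → v ∉ χb)
    (Fb : IntFencedArm m A k₀ K R₀ χb) (Fx : IntFencedArm m B k₀ K R₀ χx)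
    (hlt : Fb.z 1 < Fx.z 1) : Fb.z 1 + 8 * Fb.k < Fx.z 1 := by
  by_contra hle
  rw [not_lt] at hle
  obtain ⟨hzb0, hzb1, hzb2⟩ := Fb.z_isIntJ
  obtain ⟨hzx0, hzx1, hzx2⟩ := Fx.z_isIntJ
  have hkb : (Fb.k : ℤ) = trapScale k₀ Fb.j := rfl
  have hKb := hKm _ Fb.j_lt
  obtain ⟨t, ht, hpath⟩ := exists_pathIn_haSet_exit (k := trapScale k₀ Fb.j) hB Fb.z_isIntJ (by omega) Fx.b_far
    (by omega) Fx.path_tip.symm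
  refine Fb.tipOK.2 Fx.z t ?_ ?_ ?_ (hpath.mono fun v hv => ⟨hv.1, hcol v hv.2⟩)
  · exact Finset.mem_union_right _ (JDomain.mem_Jabove.2 ⟨Fx.z_mem_J, by simpa using hlt⟩)
  · omega
  · omega

/-- **Protection separates tips on the same side** (one region). [cite: Nolin2008, §4.4 Lemma 15 (proof) (arXiv 0711.4948: Lemma 14)] -/
theorem int_row_gap_of_lt (hA : ∀ v ∈ A, (m : ℤ) ≤ triNorm v) (hKm : ∀ j < K, 64 * trapScale k₀ j < m)
    {χb χx : SiteConfig (Site 2)} (hcol : ∀ v, v ∈ χx → v ∉ χb)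
    (Fb : IntFencedArm m A k₀ K R₀ χb) (Fx : IntFencedArm m A k₀ K R₀ χx)
    (hlt : Fb.z 1 < Fx.z 1) : Fb.z 1 + 8 * Fb.k < Fx.z 1 :=
  int_row_gap_of_lt₂ hA hKm hcol Fb Fx hlt

/-- **Compatibility on the same side** (two regions, relative rotation `d = 0`): the interior
regions of two fenced arms of complementary colours on the same side are disjoint — the higher tip
is more than `8k` above the lower one (`int_row_gap_of_lt₂`), so the rows of the two regions
separate. [cite: Nolin2008, §4.2 Def. 6–8 (arXiv 0711.4948)] -/
theorem int_compatible_same₂ {B : Set (Site 2)} (hA : ∀ v ∈ A, (m : ℤ) ≤ triNorm v) (hB : ∀ v ∈ B, (m : ℤ) ≤ triNorm v)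
    (hk₀ : 1 ≤ k₀) (hKm : ∀ j < K, 64 * trapScale k₀ j < m)
    {χo χc : SiteConfig (Site 2)} (hoc : ∀ v, v ∈ χc → v ∉ χo) (hco : ∀ v, v ∈ χo → v ∉ χc)
    (Fo : IntFencedArm m A k₀ K R₀ χo) (Fc : IntFencedArm m B k₀ K R₀ χc) :
    Disjoint Fo.intRegion Fc.intRegion := by
  have hne : Fo.z 1 ≠ Fc.z 1 := fun h => by
    have : Fo.z = Fc.z := Site.eq_iff_two.2 ⟨by rw [Fo.z_isIntJ.1, Fc.z_isIntJ.1], h⟩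
    exact hoc _ Fc.z_mem_config (this ▸ Fo.z_mem_config)
  rw [Set.disjoint_left]
  intro v hvo hvc
  rw [IntFencedArm.mem_intRegion] at hvo hvc
  rcases lt_or_gt_of_ne hne with hlt | hlt
  · have := int_row_gap_of_lt₂ hB hKm hoc Fo Fc hlt
    have hk : (1 : ℤ) ≤ Fo.k := by exact_mod_cast one_le_trapScale hk₀ Fo.j
    omega
  · have := int_row_gap_of_lt₂ hA hKm hco Fc Fo hlt
    have hk : (1 : ℤ) ≤ Fc.k := by exact_mod_cast one_le_trapScale hk₀ Fc.j
    omega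

/-- **Compatibility on the same side** (one region). [cite: Nolin2008, §4.2 Def. 6–8 (arXiv 0711.4948)] -/
theorem int_compatible_same (hA : ∀ v ∈ A, (m : ℤ) ≤ triNorm v) (hk₀ : 1 ≤ k₀) (hKm : ∀ j < K, 64 * trapScale k₀ j < m)
    {χo χc : SiteConfig (Site 2)} (hoc : ∀ v, v ∈ χc → v ∉ χo) (hco : ∀ v, v ∈ χo → v ∉ χc)
    (Fo : IntFencedArm m A k₀ K R₀ χo) (Fc : IntFencedArm m A k₀ K R₀ χc) :
    Disjoint Fo.intRegion Fc.intRegion :=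
  int_compatible_same₂ hA hA hk₀ hKm hoc hco Fo Fc

/-- **Compatibility with another side** (relative rotation `d ∈ {1, …, 5}`): the interior region
of a fenced arm and the image under `ρ^d` of the interior region of another are disjoint, by the
explicit coordinates of `ρ^d` (`rot_apply_formula`) and the margins: interior regions lie within
`2k + 1 ≤ R₀` rows above their tip, tips are at least `R₀` from the ends of their side, and
`64k < m`. No relation between the colours is needed. [cite: Nolin2008, §4.2 Def. 6–8 (arXiv 0711.4948)] -/
theorem int_compatible_rot (hKm : ∀ j < K, 64 * trapScale k₀ j < m)
    (hKR : ∀ j < K, 2 * trapScale k₀ j + 1 ≤ R₀)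
    {χb χx : SiteConfig (Site 2)} (Fb : IntFencedArm m A k₀ K R₀ χb) (Fx : IntFencedArm m A k₀ K R₀ χx)
    {d : ℕ} (hd : d = 1 ∨ d = 2 ∨ d = 3 ∨ d = 4 ∨ d = 5) : Disjoint Fb.intRegion (triRotIsoPow d '' Fx.intRegion) := by
  obtain ⟨hzb0, hzb1, hzb2⟩ := Fb.z_isIntJ
  obtain ⟨hzx0, hzx1, hzx2⟩ := Fx.z_isIntJ
  obtain ⟨hmb1, hmb2⟩ := Fb.z_mid
  obtain ⟨hmx1, hmx2⟩ := Fx.z_mid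
  have hKb := hKm _ Fb.j_lt
  have hKx := hKm _ Fx.j_lt
  have hRb := hKR _ Fb.j_lt
  have hRx := hKR _ Fx.j_lt
  have hkb' : (Fb.k : ℤ) = trapScale k₀ Fb.j := rfl
  have hkx' : (Fx.k : ℤ) = trapScale k₀ Fx.j := rfl
  have hRb' : 2 * (trapScale k₀ Fb.j : ℤ) + 1 ≤ R₀ := by exact_mod_cast hRb
  have hRx' : 2 * (trapScale k₀ Fx.j : ℤ) + 1 ≤ R₀ := by exact_mod_cast hRx
  rw [Set.disjoint_left]
  rintro v hv ⟨w, hw, rfl⟩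
  rw [IntFencedArm.mem_intRegion] at hv hw
  obtain ⟨hw0, hwn, hw1, hw2, hw3⟩ := hw
  have hwlt := triNorm_lt_iff_lin.1 hwn
  obtain ⟨-, -, h1a, h1b, h2a, h2b, h3a, h3b, h4a, h4b, h5a, h5b⟩ := rot_apply_formula w
  rcases hd with rfl | rfl | rfl | rfl | rfl
  · rw [h1a, h1b] at hv; omega
  · rw [h2a, h2b] at hv; omega
  · rw [h3a, h3b] at hv; omega
  · rw [h4a, h4b] at hv; omega
  · rw [h5a, h5b] at hv; omega

/-- **Compatibility, all relative positions**: for a fenced arm `Fo` of colour `χ₀` and a fenced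
arm `Fc` of the colour `χc` related to `χ₀` by `v ∈ χc ↔ ρ^d v ∉ χ₀` (`d < 6`), `intRegion Fo` and
`ρ^d(intRegion Fc)` are disjoint (region of norms `≥ m`, `64k < m`, `2k + 1 ≤ R₀` for all scales). [cite: Nolin2008, §4.2 Def. 6–8 (arXiv 0711.4948)] -/
theorem disjoint_intRegion_core (hA : ∀ v ∈ A, (m : ℤ) ≤ triNorm v) (hk₀ : 1 ≤ k₀)
    (hKm : ∀ j < K, 64 * trapScale k₀ j < m) (hKR : ∀ j < K, 2 * trapScale k₀ j + 1 ≤ R₀)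
    {χ₀ χc : SiteConfig (Site 2)} {d : ℕ} (hd : d < 6) (hrel : ∀ v, v ∈ χc ↔ triRotIsoPow d v ∉ χ₀)
    (Fo : IntFencedArm m A k₀ K R₀ χ₀) (Fc : IntFencedArm m A k₀ K R₀ χc) :
    Disjoint Fo.intRegion (triRotIsoPow d '' Fc.intRegion) := by
  interval_cases d
  · have hrel' : ∀ v, v ∈ χc ↔ v ∉ χ₀ := fun v => by simpa using hrel v
    have himg : triRotIsoPow 0 '' Fc.intRegion = Fc.intRegion := by
      ext v; simp only [Set.mem_image, triRotIsoPow_zero_apply, exists_eq_right]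
    rw [himg]
    exact int_compatible_same hA hk₀ hKm (fun v hv => (hrel' v).1 hv) (fun v hv hvc => (hrel' v).1 hvc hv) Fo Fc
  · exact int_compatible_rot hKm hKR Fo Fc (Or.inl rfl)
  · exact int_compatible_rot hKm hKR Fo Fc (Or.inr (Or.inl rfl))
  · exact int_compatible_rot hKm hKR Fo Fc (Or.inr (Or.inr (Or.inl rfl)))
  · exact int_compatible_rot hKm hKR Fo Fc (Or.inr (Or.inr (Or.inr (Or.inl rfl))))
  · exact int_compatible_rot hKm hKR Fo Fc (Or.inr (Or.inr (Or.inr (Or.inr rfl))))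

/-- **Compatibility of the inner free spaces of the two arms** (the geometric input of the
independent inward extension of the two arms by the locally monotone FKG inequality, Nolin 2008,
Lemma 13 and Prop. 12 (i)): if the open arm is fenced at its inner end in the frame `io` and the
closed arm in the frame `ic`, then back in the original frame the interior regions
`ρ^{io}(intRegion Fo)` and `ρ^{ic}(intRegion Fc)` — which contain the fence boxes and the interior
parts of the two fence zones — are disjoint sets of sites of `Λ̊_m`. [cite: Nolin2008, §4.2 Def. 6–8 and §4.3 Prop. 12 (arXiv 0711.4948: Prop. 11)] -/
theorem disjoint_intRegion_image (hA : ∀ v ∈ A, (m : ℤ) ≤ triNorm v) (hk₀ : 1 ≤ k₀)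
    (hKm : ∀ j < K, 64 * trapScale k₀ j < m) (hKR : ∀ j < K, 2 * trapScale k₀ j + 1 ≤ R₀)
    {ω : SiteConfig (Site 2)} {io ic : ℕ} (hio : io < 6)
    (Fo : IntFencedArm m A k₀ K R₀ (rotConfig io ω)) (Fc : IntFencedArm m A k₀ K R₀ (rotConfig ic ω)ᶜ) :
    Disjoint (triRotIsoPow io '' Fo.intRegion) (triRotIsoPow ic '' Fc.intRegion) := by
  set d := (ic + (6 - io)) % 6 with hd
  have hd6 : d < 6 := Nat.mod_lt _ (by norm_num)
  have hcomp : ∀ v : Site 2, triRotIsoPow io (triRotIsoPow d v) = triRotIsoPow ic v := by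
    intro v
    rw [hd, triRotIsoPow_mod_six_apply, ← triRotIsoPow_add_apply,
      show ic + (6 - io) + io = ic + 6 by omega, triRotIsoPow_add_six_apply]
  have hrel : ∀ v, v ∈ (rotConfig ic ω)ᶜ ↔ triRotIsoPow d v ∉ rotConfig io ω := by
    intro v
    rw [Set.mem_compl_iff, mem_rotConfig, mem_rotConfig, hcomp]
  have hcore := disjoint_intRegion_core hA hk₀ hKm hKR hd6 hrel Fo Fc
  rw [Set.disjoint_left] at hcore ⊢
  rintro x ⟨v, hv, rfl⟩ ⟨w, hw, hwv⟩
  rw [← hcomp w] at hwv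
  have hinj : triRotIsoPow d w = v := (triRotIsoPow io).injective hwv
  exact hcore hv ⟨w, hw, hinj⟩

end Compatibility

end Literature.Probability.Percolation
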